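import Summits.QuantumFields.YangMills.Theorems.ColdStartUniversalityLatticeLangevinPlaquetteCarre
import Summits.QuantumFields.YangMills.Theorems.ColdStartUniversalityLatticeLangevinBakryEmeryConcentration
import Literature.MathematicalPhysics.QuantumFieldTheory.Balaban1983to89.MassGapTransferHC
import HarnessLib

/-!
# Route `ColdStartUniversality` (fixed-cut-off package, Bakry–Émery side): VOLUME-UNIFORM GAUSSIAN CONCENTRATION OF THE ACTION DENSITY
# under the SU(2) Wilson measure `μ_(β')` on `(ℤ/L)³` at `|β'| < 1/12` — `μ_(β'){|S_W/#𝒫 − ⟨S_W/#𝒫⟩| ≥ r} ≤ 2·exp(−(1−12|β'|)·#𝒫·r²/64)`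

Helper file (seat `ym-line-csu-p1`, g27; `--supports stmt-QuantumFields-24809`).  The plaquette (action) density
`S_W(V)/#𝒫 = (#𝒫)⁻¹ Σ_p (2 − Re tr U_p)` of an `SU(2)` lattice gauge field on the torus `(ℤ/L)³` (`#𝒫 = 3L³` plaquettes) concentrates
around its mean at the CLT scale `r ≍ #𝒫^(−1/2)`, with a Gaussian tail whose rate does NOT degrade with the volume, for every coupling in
the Bakry–Émery window `|β'| < 1/12`:
* ★★★ `wilson_actionDensity_concentration_uniform` — for every `L`, `|β'| < 1/12`, `r ≥ 0`:
  `μ_(β') {V | r ≤ |S_W(V)/#𝒫 − ∫ S_W/#𝒫 dμ_(β')|} ≤ 2·exp(−(1 − 12|β'|)·#𝒫·r²/64)`;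
* `wilson_actionDensity_lowerTail_uniform` / `_upperTail_uniform` — the one-sided bounds without the factor `2`;
* `wilson_actionDensity_concentration_uniform_volume` — the same with `#𝒫 = 3L³` spelled out (`card_plaquette_three`).
Proof: the volume-uniform log-Sobolev inequality (g26 `wilson_generatorLogSobolev_uniform`, constant `(1−12|β'|)/2`) ⇒ Herbst ⇒
`wilson_concentration_uniform` for `C³` cylinder functions with `Γ(f) ≤ s`, applied to `f = ±ψ̂_b`, `b = 1/#𝒫`
(`ψ̂_b(coords V) = 2 − S_W(V)/#𝒫`, `neg_mul_wilsonAction_eq_psiHat`), whose carré du champ is at most `64 b² #𝒫 = 64/#𝒫`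
(`wilson_plaquette_carre_le`, `…PlaquetteCarre`).  Compare: at `β' = 0` (product Haar) the density is an average of `#𝒫` weakly dependent
bounded terms and Hoeffding-type bounds give the same scale; the point is the `L`-independent rate at `β' ≠ 0`.
[cite: ShenZhuZhu2022, §4 Theorem 4.2, Corollary 4.4] (log-Sobolev/Poincaré for `μ_(Λ_L,N,β)` by Bakry–Émery) with Ledoux's Herbst argument.
HONEST FRAMING: FIXED cut-off and fixed `|β'| < 1/12` ("uniform" = in the torus size `L`); the route's scaling `β'_K → ∞` leaves the window;
24809 ASIDE not restated; no crux, rung or summit statement is proved; the Yang–Mills mass gap is NOT proved.  THEOREMS ONLY, no definition, no sorry.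
-/

set_option autoImplicit false

noncomputable section

namespace Summit.QuantumFields.YangMills.Theorems.ColdStartUniversality

open MeasureTheory ProbabilityTheory Finset Filter Set
open scoped BigOperators NNReal ENNReal Topology
open Literature.MathematicalPhysics.QuantumFieldTheory
open Literature.MathematicalPhysics.QuantumLattice (fundamentalRep fundamentalLatticeRep continuous_fundamentalRep)

variable {L : ℕ} [NeZero L]

/-! ## §1. Counting and the plaquette function at coefficient `b` -/

/-- `0 < #𝒫`. [folklore] -/
theorem card_plaquette_three_pos (L : ℕ) [NeZero L] : 0 < (Fintype.card (Plaquette 3 L) : ℝ) := by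
  rw [card_plaquette_three]
  have hL : 0 < L := Nat.pos_of_ne_zero (NeZero.ne L)
  positivity

/-- **The plaquette function reads the action density**: `ψ̂_b(coords V) = 2b·#𝒫 − b·S_W(V)` (`S_W = Σ_p (2 − Re tr U_p)`). [folklore] -/
theorem psiHat_coords_eq_wilsonAction (b : ℝ) (V : (GaugeConfig 3 L (Matrix.specialUnitaryGroup (Fin 2) ℂ))) :
    (fun y : (Edge 3 L × Fin 2 × Fin 2 × Bool → ℝ) => b * ∑ p : Plaquette 3 L, (rootedLoop (fun (ee : Edge 3 L) (i j : Fin 2) => ((y (ee, i, j, false) : ℝ) : ℂ) + ((y (ee, i, j, true) : ℝ) : ℂ) * Complex.I) (p.1, p.2.1.1) p.2.1.2 false).trace.re) ((fun (V : GaugeConfig 3 L (Matrix.specialUnitaryGroup (Fin 2) ℂ)) (q : Edge 3 L × Fin 2 × Fin 2 × Bool) => (fun z : ℂ => if q.2.2.2 then z.im else z.re) ((fundamentalRep (Fin 2) (V q.1) : Matrix (Fin 2) (Fin 2) ℂ) q.2.1 q.2.2.1)) V) = 2 * b * (Fintype.card (Plaquette 3 L) : ℝ) - b * wilsonAction (fundamentalRep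 (Fin 2)) V := by
  have h : -b * wilsonAction (fundamentalRep (Fin 2)) V = (fun y : (Edge 3 L × Fin 2 × Fin 2 × Bool → ℝ) => b * ∑ p : Plaquette 3 L, (rootedLoop (fun (ee : Edge 3 L) (i j : Fin 2) => ((y (ee, i, j, false) : ℝ) : ℂ) + ((y (ee, i, j, true) : ℝ) : ℂ) * Complex.I) (p.1, p.2.1.1) p.2.1.2 false).trace.re) ((fun (V : GaugeConfig 3 L (Matrix.specialUnitaryGroup (Fin 2) ℂ)) (q : Edge 3 L × Fin 2 × Fin 2 × Bool) => (fun z : ℂ => if q.2.2.2 then z.im else z.re) ((fundamentalRep (Fin 2) (V q.1) : Matrix (Fin 2) (Fin 2) ℂ) q.2.1 q.2.2.1)) V) - 2 * b * (Fintype.card (Plaquette 3 L) : ℝ) :=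
    neg_mul_wilsonAction_eq_psiHat b V
  linarith

/-! ## §2. Concentration of the action density -/

/-- **Lower tail of the action density, volume-uniform.**  For every `L`, `|β'| < 1/12`, `r ≥ 0`:
`μ_(β') {V | S_W(V)/#𝒫 ≤ ∫ S_W/#𝒫 dμ_(β') − r} ≤ exp(−(1 − 12|β'|)·#𝒫·r²/64)`. [cite: ShenZhuZhu2022, §4 Theorem 4.2, Corollary 4.4] -/
theorem wilson_actionDensity_lowerTail_uniform (L : ℕ) [NeZero L] (β' : ℝ) (hβ : |β'| < 1 / 12) (r : ℝ) (hr : 0 ≤ r) :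
    ((wilsonMeasure (d := 3) (L := L) (fundamentalRep (Fin 2)) β')).real {V | wilsonAction (fundamentalRep (Fin 2)) V / (Fintype.card (Plaquette 3 L) : ℝ) ≤
        (∫ V', wilsonAction (fundamentalRep (Fin 2)) V' / (Fintype.card (Plaquette 3 L) : ℝ) ∂(wilsonMeasure (d := 3) (L := L) (fundamentalRep (Fin 2)) β')) - r} ≤
      Real.exp (-((1 - 12 * |β'|) * (Fintype.card (Plaquette 3 L) : ℝ) * r ^ 2 / 64)) := by
  classical
  haveI := secondCountableTopology_su2
  haveI := borelSpace_config L
  set μ : Measure (GaugeConfig 3 L (Matrix.specialUnitaryGroup (Fin 2) ℂ)) := (wilsonMeasure (d := 3) (L := L) (fundamentalRep (Fin 2)) β') with hμ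
  haveI : IsProbabilityMeasure μ :=
    isProbabilityMeasure_wilsonMeasure (d := 3) (L := L) (fundamentalRep (Fin 2)) (continuous_fundamentalRep (Fin 2)) β'
  set nP : ℝ := (Fintype.card (Plaquette 3 L) : ℝ) with hnP
  have hnPpos : 0 < nP := card_plaquette_three_pos L
  set b : ℝ := nP⁻¹ with hb
  have hbn : b * nP = 1 := inv_mul_cancel₀ hnPpos.ne'
  set co : (GaugeConfig 3 L (Matrix.specialUnitaryGroup (Fin 2) ℂ)) → (Edge 3 L × Fin 2 × Fin 2 × Bool → ℝ) := (fun (V : GaugeConfig 3 L (Matrix.specialUnitaryGroup (Fin 2) ℂ)) (q : Edge 3 L × Fin 2 × Fin 2 × Bool) => (fun z : ℂ => if q.2.2.2 then z.im else z.re) ((fundamentalRep (Fin 2) (V q.1) : Matrix (Fin 2) (Fin 2) ℂ) q.2.1 q.2.2.1)) with hco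
  set fp : (Edge 3 L × Fin 2 × Fin 2 × Bool → ℝ) → ℝ := (fun y : (Edge 3 L × Fin 2 × Fin 2 × Bool → ℝ) => b * ∑ p : Plaquette 3 L, (rootedLoop (fun (ee : Edge 3 L) (i j : Fin 2) => ((y (ee, i, j, false) : ℝ) : ℂ) + ((y (ee, i, j, true) : ℝ) : ℂ) * Complex.I) (p.1, p.2.1.1) p.2.1.2 false).trace.re) with hfp
  have hfpC : ContDiff ℝ 3 fp := contDiff_psiHat (d := 3) (L := L) (N := 2) (n := 3) b
  -- values and mean
  have hval : ∀ V, fp (co V) = 2 - wilsonAction (fundamentalRep (Fin 2)) V / nP := by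
    intro V
    have h : fp (co V) = 2 * b * nP - b * wilsonAction (fundamentalRep (Fin 2)) V := psiHat_coords_eq_wilsonAction b V
    rw [h, div_eq_mul_inv, hb]
    have : 2 * nP⁻¹ * nP = 2 := by rw [mul_assoc, inv_mul_cancel₀ hnPpos.ne', mul_one]
    rw [this]; ring
  have hcont : Continuous fun V => fp (co V) := hfpC.continuous.comp (continuous_coords (L := L))
  have hint : Integrable (fun V => wilsonAction (fundamentalRep (Fin 2)) V / nP) μ := by
    have hfun : (fun V => wilsonAction (fundamentalRep (Fin 2)) V / nP) = fun V => 2 - fp (co V) := funext fun V => by rw [hval]; ring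
    rw [hfun]
    exact integrable_of_continuous_of_compactSpace (continuous_const.sub hcont) _
  have hmean : ∫ V', fp (co V') ∂μ = 2 - ∫ V', wilsonAction (fundamentalRep (Fin 2)) V' / nP ∂μ := by
    have hfun : (fun V' => fp (co V')) = fun V' => (2 : ℝ) - wilsonAction (fundamentalRep (Fin 2)) V' / nP := funext hval
    rw [hfun, integral_sub (integrable_const _) hint, integral_const]
    simp
  -- carré du champ bound and concentration
  have hs : 0 < 64 * b ^ 2 * nP := by positivity
  have hconc : μ.real {V | (∫ V', fp (co V') ∂μ) + r ≤ fp (co V)} ≤ Real.exp (-((1 - 12 * |β'|) * r ^ 2 / (64 * b ^ 2 * nP))) :=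
    wilson_concentration_uniform L β' hβ fp hfpC hs (wilson_plaquette_carre_le L β' b) r hr
  -- the events coincide
  have hset : {V : (GaugeConfig 3 L (Matrix.specialUnitaryGroup (Fin 2) ℂ)) | wilsonAction (fundamentalRep (Fin 2)) V / nP ≤ (∫ V', wilsonAction (fundamentalRep (Fin 2)) V' / nP ∂μ) - r} ⊆
      {V | (∫ V', fp (co V') ∂μ) + r ≤ fp (co V)} := by
    intro V hV
    simp only [Set.mem_setOf_eq] at hV ⊢
    rw [hmean, hval]
    linarith
  have hexp : Real.exp (-((1 - 12 * |β'|) * r ^ 2 / (64 * b ^ 2 * nP))) = Real.exp (-((1 - 12 * |β'|) * nP * r ^ 2 / 64)) := by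
    congr 1
    rw [hb]
    field_simp
  calc μ.real {V : (GaugeConfig 3 L (Matrix.specialUnitaryGroup (Fin 2) ℂ)) | wilsonAction (fundamentalRep (Fin 2)) V / nP ≤ (∫ V', wilsonAction (fundamentalRep (Fin 2)) V' / nP ∂μ) - r}
      ≤ μ.real {V | (∫ V', fp (co V') ∂μ) + r ≤ fp (co V)} := measureReal_mono hset
    _ ≤ Real.exp (-((1 - 12 * |β'|) * r ^ 2 / (64 * b ^ 2 * nP))) := hconc
    _ = Real.exp (-((1 - 12 * |β'|) * nP * r ^ 2 / 64)) := hexp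

/-- **Upper tail of the action density, volume-uniform.**  For every `L`, `|β'| < 1/12`, `r ≥ 0`:
`μ_(β') {V | ∫ S_W/#𝒫 dμ_(β') + r ≤ S_W(V)/#𝒫} ≤ exp(−(1 − 12|β'|)·#𝒫·r²/64)`. [cite: ShenZhuZhu2022, §4 Theorem 4.2, Corollary 4.4] -/
theorem wilson_actionDensity_upperTail_uniform (L : ℕ) [NeZero L] (β' : ℝ) (hβ : |β'| < 1 / 12) (r : ℝ) (hr : 0 ≤ r) :
    ((wilsonMeasure (d := 3) (L := L) (fundamentalRep (Fin 2)) β')).real {V | (∫ V', wilsonAction (fundamentalRep (Fin 2)) V' / (Fintype.card (Plaquette 3 L) : ℝ) ∂(wilsonMeasure (d := 3) (L := L) (fundamentalRep (Fin 2)) β')) + r ≤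
        wilsonAction (fundamentalRep (Fin 2)) V / (Fintype.card (Plaquette 3 L) : ℝ)} ≤
      Real.exp (-((1 - 12 * |β'|) * (Fintype.card (Plaquette 3 L) : ℝ) * r ^ 2 / 64)) := by
  classical
  haveI := secondCountableTopology_su2
  haveI := borelSpace_config L
  set μ : Measure (GaugeConfig 3 L (Matrix.specialUnitaryGroup (Fin 2) ℂ)) := (wilsonMeasure (d := 3) (L := L) (fundamentalRep (Fin 2)) β') with hμ
  haveI : IsProbabilityMeasure μ :=
    isProbabilityMeasure_wilsonMeasure (d := 3) (L := L) (fundamentalRep (Fin 2)) (continuous_fundamentalRep (Fin 2)) β'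
  set nP : ℝ := (Fintype.card (Plaquette 3 L) : ℝ) with hnP
  have hnPpos : 0 < nP := card_plaquette_three_pos L
  set b : ℝ := nP⁻¹ with hb
  set co : (GaugeConfig 3 L (Matrix.specialUnitaryGroup (Fin 2) ℂ)) → (Edge 3 L × Fin 2 × Fin 2 × Bool → ℝ) := (fun (V : GaugeConfig 3 L (Matrix.specialUnitaryGroup (Fin 2) ℂ)) (q : Edge 3 L × Fin 2 × Fin 2 × Bool) => (fun z : ℂ => if q.2.2.2 then z.im else z.re) ((fundamentalRep (Fin 2) (V q.1) : Matrix (Fin 2) (Fin 2) ℂ) q.2.1 q.2.2.1)) with hco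
  set fm : (Edge 3 L × Fin 2 × Fin 2 × Bool → ℝ) → ℝ := (fun y : (Edge 3 L × Fin 2 × Fin 2 × Bool → ℝ) => (-b) * ∑ p : Plaquette 3 L, (rootedLoop (fun (ee : Edge 3 L) (i j : Fin 2) => ((y (ee, i, j, false) : ℝ) : ℂ) + ((y (ee, i, j, true) : ℝ) : ℂ) * Complex.I) (p.1, p.2.1.1) p.2.1.2 false).trace.re) with hfm
  have hfmC : ContDiff ℝ 3 fm := contDiff_psiHat (d := 3) (L := L) (N := 2) (n := 3) (-b)
  -- values and mean
  have hval : ∀ V, fm (co V) = wilsonAction (fundamentalRep (Fin 2)) V / nP - 2 := by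
    intro V
    have h : fm (co V) = 2 * (-b) * nP - (-b) * wilsonAction (fundamentalRep (Fin 2)) V := psiHat_coords_eq_wilsonAction (-b) V
    rw [h, div_eq_mul_inv, hb]
    have : 2 * nP⁻¹ * nP = 2 := by rw [mul_assoc, inv_mul_cancel₀ hnPpos.ne', mul_one]
    calc 2 * -nP⁻¹ * nP - -nP⁻¹ * wilsonAction (fundamentalRep (Fin 2)) V = -(2 * nP⁻¹ * nP) + wilsonAction (fundamentalRep (Fin 2)) V * nP⁻¹ := by ring
      _ = wilsonAction (fundamentalRep (Fin 2)) V * nP⁻¹ - 2 := by rw [this]; ring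
  have hcont : Continuous fun V => fm (co V) := hfmC.continuous.comp (continuous_coords (L := L))
  have hint : Integrable (fun V => wilsonAction (fundamentalRep (Fin 2)) V / nP) μ := by
    have hfun : (fun V => wilsonAction (fundamentalRep (Fin 2)) V / nP) = fun V => fm (co V) + 2 := funext fun V => by rw [hval]; ring
    rw [hfun]
    exact integrable_of_continuous_of_compactSpace (hcont.add continuous_const) _
  have hmean : ∫ V', fm (co V') ∂μ = (∫ V', wilsonAction (fundamentalRep (Fin 2)) V' / nP ∂μ) - 2 := by
    have hfun : (fun V' => fm (co V')) = fun V' => wilsonAction (fundamentalRep (Fin 2)) V' / nP - (2 : ℝ) := funext hval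
    rw [hfun, integral_sub hint (integrable_const _), integral_const]
    simp
  -- carré du champ bound and concentration
  have hs : 0 < 64 * (-b) ^ 2 * nP := by rw [neg_sq]; positivity
  have hconc : μ.real {V | (∫ V', fm (co V') ∂μ) + r ≤ fm (co V)} ≤ Real.exp (-((1 - 12 * |β'|) * r ^ 2 / (64 * (-b) ^ 2 * nP))) :=
    wilson_concentration_uniform L β' hβ fm hfmC hs (wilson_plaquette_carre_le L β' (-b)) r hr
  have hset : {V : (GaugeConfig 3 L (Matrix.specialUnitaryGroup (Fin 2) ℂ)) | (∫ V', wilsonAction (fundamentalRep (Fin 2)) V' / nP ∂μ) + r ≤ wilsonAction (fundamentalRep (Fin 2)) V / nP} ⊆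
      {V | (∫ V', fm (co V') ∂μ) + r ≤ fm (co V)} := by
    intro V hV
    simp only [Set.mem_setOf_eq] at hV ⊢
    rw [hmean, hval]
    linarith
  have hexp : Real.exp (-((1 - 12 * |β'|) * r ^ 2 / (64 * (-b) ^ 2 * nP))) = Real.exp (-((1 - 12 * |β'|) * nP * r ^ 2 / 64)) := by
    congr 1
    rw [neg_sq, hb]
    field_simp
  calc μ.real {V : (GaugeConfig 3 L (Matrix.specialUnitaryGroup (Fin 2) ℂ)) | (∫ V', wilsonAction (fundamentalRep (Fin 2)) V' / nP ∂μ) + r ≤ wilsonAction (fundamentalRep (Fin 2)) V / nP}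
      ≤ μ.real {V | (∫ V', fm (co V') ∂μ) + r ≤ fm (co V)} := measureReal_mono hset
    _ ≤ Real.exp (-((1 - 12 * |β'|) * r ^ 2 / (64 * (-b) ^ 2 * nP))) := hconc
    _ = Real.exp (-((1 - 12 * |β'|) * nP * r ^ 2 / 64)) := hexp

/-- ★★★ **Volume-uniform Gaussian concentration of the action density at strong coupling.**  For the `SU(2)` Wilson measure
`μ_(β')` on the torus `(ℤ/L)³` — every `L ≥ 1`, every `|β'| < 1/12`, every `r ≥ 0` — the plaquette (action) density
`S_W/#𝒫 = (#𝒫)⁻¹ Σ_p (2 − Re tr U_p)` satisfies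
`μ_(β') {V | r ≤ |S_W(V)/#𝒫 − ∫ S_W/#𝒫 dμ_(β')|} ≤ 2 · exp(−(1 − 12|β'|) · #𝒫 · r² / 64)`:
fluctuations of order `#𝒫^(−1/2)` with an `L`-independent sub-Gaussian constant (log-Sobolev + Herbst + `Γ(S_W/#𝒫) ≤ 64/#𝒫`).
Fixed cut-off, small `|β'|` only. [cite: ShenZhuZhu2022, §4 Theorem 4.2, Corollary 4.4] -/
theorem wilson_actionDensity_concentration_uniform (L : ℕ) [NeZero L] (β' : ℝ) (hβ : |β'| < 1 / 12) (r : ℝ) (hr : 0 ≤ r) :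
    ((wilsonMeasure (d := 3) (L := L) (fundamentalRep (Fin 2)) β')).real {V | r ≤ |wilsonAction (fundamentalRep (Fin 2)) V / (Fintype.card (Plaquette 3 L) : ℝ) -
        ∫ V', wilsonAction (fundamentalRep (Fin 2)) V' / (Fintype.card (Plaquette 3 L) : ℝ) ∂(wilsonMeasure (d := 3) (L := L) (fundamentalRep (Fin 2)) β')|} ≤
      2 * Real.exp (-((1 - 12 * |β'|) * (Fintype.card (Plaquette 3 L) : ℝ) * r ^ 2 / 64)) := by
  classical
  haveI := secondCountableTopology_su2
  haveI := borelSpace_config L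
  haveI : IsProbabilityMeasure (wilsonMeasure (d := 3) (L := L) (fundamentalRep (Fin 2)) β') :=
    isProbabilityMeasure_wilsonMeasure (d := 3) (L := L) (fundamentalRep (Fin 2)) (continuous_fundamentalRep (Fin 2)) β'
  have hsub : {V : (GaugeConfig 3 L (Matrix.specialUnitaryGroup (Fin 2) ℂ)) | r ≤ |wilsonAction (fundamentalRep (Fin 2)) V / (Fintype.card (Plaquette 3 L) : ℝ) -
        ∫ V', wilsonAction (fundamentalRep (Fin 2)) V' / (Fintype.card (Plaquette 3 L) : ℝ) ∂(wilsonMeasure (d := 3) (L := L) (fundamentalRep (Fin 2)) β')|} ⊆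
      {V | wilsonAction (fundamentalRep (Fin 2)) V / (Fintype.card (Plaquette 3 L) : ℝ) ≤ (∫ V', wilsonAction (fundamentalRep (Fin 2)) V' / (Fintype.card (Plaquette 3 L) : ℝ) ∂(wilsonMeasure (d := 3) (L := L) (fundamentalRep (Fin 2)) β')) - r} ∪
      {V | (∫ V', wilsonAction (fundamentalRep (Fin 2)) V' / (Fintype.card (Plaquette 3 L) : ℝ) ∂(wilsonMeasure (d := 3) (L := L) (fundamentalRep (Fin 2)) β')) + r ≤ wilsonAction (fundamentalRep (Fin 2)) V / (Fintype.card (Plaquette 3 L) : ℝ)} := by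
    intro V hV
    simp only [Set.mem_setOf_eq, Set.mem_union] at hV ⊢
    rcases le_abs.1 hV with h | h
    · right; linarith
    · left; linarith
  calc ((wilsonMeasure (d := 3) (L := L) (fundamentalRep (Fin 2)) β')).real {V | r ≤ |wilsonAction (fundamentalRep (Fin 2)) V / (Fintype.card (Plaquette 3 L) : ℝ) -
        ∫ V', wilsonAction (fundamentalRep (Fin 2)) V' / (Fintype.card (Plaquette 3 L) : ℝ) ∂(wilsonMeasure (d := 3) (L := L) (fundamentalRep (Fin 2)) β')|}
      ≤ ((wilsonMeasure (d := 3) (L := L) (fundamentalRep (Fin 2)) β')).real ({V | wilsonAction (fundamentalRep (Fin 2)) V / (Fintype.card (Plaquette 3 L) : ℝ) ≤ (∫ V', wilsonAction (fundamentalRep (Fin 2)) V' / (Fintype.card (Plaquette 3 L) : ℝ) ∂(wilsonMeasure (d := 3) (L := L) (fundamentalRep (Fin 2)) β')) - r} ∪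
          {V | (∫ V', wilsonAction (fundamentalRep (Fin 2)) V' / (Fintype.card (Plaquette 3 L) : ℝ) ∂(wilsonMeasure (d := 3) (L := L) (fundamentalRep (Fin 2)) β')) + r ≤ wilsonAction (fundamentalRep (Fin 2)) V / (Fintype.card (Plaquette 3 L) : ℝ)}) := measureReal_mono hsub
    _ ≤ ((wilsonMeasure (d := 3) (L := L) (fundamentalRep (Fin 2)) β')).real {V | wilsonAction (fundamentalRep (Fin 2)) V / (Fintype.card (Plaquette 3 L) : ℝ) ≤ (∫ V', wilsonAction (fundamentalRep (Fin 2)) V' / (Fintype.card (Plaquette 3 L) : ℝ) ∂(wilsonMeasure (d := 3) (L := L) (fundamentalRep (Fin 2)) β')) - r} +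
          ((wilsonMeasure (d := 3) (L := L) (fundamentalRep (Fin 2)) β')).real {V | (∫ V', wilsonAction (fundamentalRep (Fin 2)) V' / (Fintype.card (Plaquette 3 L) : ℝ) ∂(wilsonMeasure (d := 3) (L := L) (fundamentalRep (Fin 2)) β')) + r ≤ wilsonAction (fundamentalRep (Fin 2)) V / (Fintype.card (Plaquette 3 L) : ℝ)} := measureReal_union_le _ _
    _ ≤ Real.exp (-((1 - 12 * |β'|) * (Fintype.card (Plaquette 3 L) : ℝ) * r ^ 2 / 64)) + Real.exp (-((1 - 12 * |β'|) * (Fintype.card (Plaquette 3 L) : ℝ) * r ^ 2 / 64)) :=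
        add_le_add (wilson_actionDensity_lowerTail_uniform L β' hβ r hr) (wilson_actionDensity_upperTail_uniform L β' hβ r hr)
    _ = 2 * Real.exp (-((1 - 12 * |β'|) * (Fintype.card (Plaquette 3 L) : ℝ) * r ^ 2 / 64)) := by ring

/-- ★★★ **The same with `#𝒫 = 3L³` spelled out**: for every `L ≥ 1`, `|β'| < 1/12`, `r ≥ 0`,
`μ_(β') {V | r ≤ |S_W(V)/(3L³) − ∫ S_W/(3L³) dμ_(β')|} ≤ 2·exp(−(1 − 12|β'|)·3L³·r²/64)` — the tail improves with the volume at fixed `r`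
and is volume-independent at the CLT scale `r = x·(3L³)^(−1/2)`. [cite: ShenZhuZhu2022, §4 Theorem 4.2, Corollary 4.4] -/
theorem wilson_actionDensity_concentration_uniform_volume (L : ℕ) [NeZero L] (β' : ℝ) (hβ : |β'| < 1 / 12) (r : ℝ) (hr : 0 ≤ r) :
    ((wilsonMeasure (d := 3) (L := L) (fundamentalRep (Fin 2)) β')).real {V | r ≤ |wilsonAction (fundamentalRep (Fin 2)) V / (3 * (L : ℝ) ^ 3) -
        ∫ V', wilsonAction (fundamentalRep (Fin 2)) V' / (3 * (L : ℝ) ^ 3) ∂(wilsonMeasure (d := 3) (L := L) (fundamentalRep (Fin 2)) β')|} ≤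
      2 * Real.exp (-((1 - 12 * |β'|) * (3 * (L : ℝ) ^ 3) * r ^ 2 / 64)) := by
  have h := wilson_actionDensity_concentration_uniform L β' hβ r hr
  have hc : (Fintype.card (Plaquette 3 L) : ℝ) = 3 * (L : ℝ) ^ 3 := by
    rw [card_plaquette_three]; push_cast; ring
  rw [hc] at h
  exact h

end Summit.QuantumFields.YangMills.Theorems.ColdStartUniversality
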